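import Literature.AlgebraicGeometry.Motives.TateConjectureStrongFormFiniteField
import HarnessLib

/-!
# The multiplicity of `q^r` as an inverse root of `P_{2r}(X, t)`: Tate's theorem with the
# characteristic polynomial of Frobenius (Milne 1986 §8 `T(X, r, ℓ)`; Tate 1994 Th. 2.9)

Topic `Literature/AlgebraicGeometry/Motives`; THEOREMS ONLY (no definition, no named fact).

Companion of `TateConjectureStrongFormFiniteField` (row g37-#2). There the "multiplicity" side of
Tate's theorem is the dimension of the generalized eigenspace `H^{2r}(X)(r)_1` of the twisted
Frobenius `φ_r = χ(F)^r F` (`Module.End.maxGenEigenspace (E.ρTwist X (2r) r (geomFrob k)) 1`).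
Milne 1986 states `T(X, r, ℓ)` as «the dimension of `B^r_ℓ(X)` is the multiplicity of `q^r` as an
inverse root of `P_{2r}(X, t)`», `P_{2r}(X, t) = det(1 - tF | H^{2r})` — the tree's
`E.frobCharPoly X (2r)` (`FrobeniusTrace`: the reverse of the characteristic polynomial of
`F = E.frobAction X (2r)`). An inverse root `α` of `P(t) = ∏ (1 - αᵢ t)` of multiplicity `m` is a
root `t = α⁻¹` of multiplicity `m`; with `χ(F) = q⁻¹` (cyclotomic character, geometric Frobenius)
the inverse root `q^r` is the root `χ(F)^r`. This file proves, for `X` smooth projective over the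
finite field `k` and `c = χ(geomFrob k)`,

  `dim_K H^{i}(X)(j)_1 = mult_{c^j} P_i(X, t)`  (`finrank_maxGenEigenspace_ρTwist_eq_rootMultiplicity`),

i.e. the dimension of the generalized eigenspace of `1` for `c^j F` on `Hⁱ(X)` is the multiplicity of
`c^j` as a root of `det(1 - tF | Hⁱ(X))` (§1: `mult_{a⁻¹}(p.reverse) = mult_a(p)`, a private copy of
the tree's `rootMultiplicity_inv_reverse` of `NumberTheory/EllipticCurves/FunctionFieldEllipticLFormalOrderProofs`
inlined to keep the import closure of `Motives` free of complex analysis; §2: generalized eigenspaces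
of `a • f`; Mathlib `LinearMap.finrank_maxGenEigenspace_eq`), and restates the theorems of row
g37-#2 in Milne's literal form (§3): the chain `ρ_r ≤ dim K·Aʳ(X) ≤ mult_{c^r} P_{2r}`,
**Prop. 8.2** `dim K·Aʳ(X) = mult_{c^r} P_{2r} ⟺ T′ ∧ SS`, **Tate Th. 2.9 (c)**
`ρ_r = mult_{c^r} P_{2r} ⟺ T^r ∧ E^r`, and the duality `mult_{c^s} P_{2s} = mult_{c^r} P_{2r}`
(`r + s = dim X`; for `c = q⁻¹`: `q^{d-r}` and `q^r` are inverse roots of `P_{2(d-r)}`, `P_{2r}` with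
the same multiplicity).

Sources: J. S. Milne, *Values of zeta functions of varieties over finite fields*, Amer. J. Math.
108 (1986) §8 p. 345 (`T(X, r, ℓ)`), Prop. 8.2; J. Tate, PSPM 55.1 (1994) §2 Th. 2.9 (through
B. Kahn, *Zeta and L-functions of varieties and motives* (2020) §6.14 Th. 6.53 and J. S. Milne,
arXiv:0709.3040 Th. 1.2); P. Deligne, *La conjecture de Weil. I* (1974) (1.5.4) for
`P_i(X, t) = det(1 - tF | Hⁱ)`.

## Provenance

Lane `lit-hodgefound` (summit `HodgeConjecture`, Track 2 foundations library, Layer B: motives),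
seat `lit-hodgefound-p29` (literature-prover, generation 37, row g37-#3).
-/

universe u v

open CategoryTheory AlgebraicGeometry Polynomial

noncomputable section

namespace Literature.AlgebraicGeometry.Motives

open Literature.LinearAlgebra

/-! ## §1 Roots of the reciprocal polynomial -/

/-- `mult_{c⁻¹}(p.reverse) = mult_c(p)` for `c ≠ 0` over a field — same statement and proof as the
tree's `rootMultiplicity_inv_reverse` (`NumberTheory/EllipticCurves/FunctionFieldEllipticLFormalOrderProofs`),
inlined (private) to keep the import closure of `Motives` light. [folklore] -/
private theorem rootMultiplicity_inv_reverse_aux {K : Type*} [Field K] (p : K[X]) {c : K}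
    (hc : c ≠ 0) : p.reverse.rootMultiplicity c⁻¹ = p.rootMultiplicity c := by
  classical
  by_cases hp : p = 0
  · simp [hp]
  set m := p.rootMultiplicity c with hm
  set r := p /ₘ (X - C c) ^ m with hr
  have hdec : (X - C c) ^ m * r = p := p.pow_mul_divByMonic_rootMultiplicity_eq c
  have hrc : r.eval c ≠ 0 := eval_divByMonic_pow_rootMultiplicity_ne_zero c hp
  have hr0 : r ≠ 0 := fun h => hrc (by rw [h, eval_zero])
  have h1 : (1 - C c * X : K[X]) = C (-c) * (X - C c⁻¹) := by
    have : C c * C c⁻¹ = (1 : K[X]) := by rw [← C_mul, mul_inv_cancel₀ hc, C_1]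
    rw [C_neg]
    linear_combination -this
  have hrevpow : ∀ n : ℕ, ((X - C c : K[X]) ^ n).reverse = (X - C c : K[X]).reverse ^ n := by
    intro n
    induction n with
    | zero => rw [pow_zero, pow_zero, ← C_1, reverse_C]
    | succ n ih => rw [pow_succ, reverse_mul_of_domain, ih, pow_succ]
  have hrevX : (X - C c : K[X]).reverse = 1 - C c * X := by
    have hX : (X : K[X]).reverse = 1 := by rw [← one_mul X, reverse_mul_X, ← C_1, reverse_C]
    rw [sub_eq_add_neg, ← C_neg, reverse_add_C, hX, natDegree_X, pow_one, C_neg, neg_mul,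
      ← sub_eq_add_neg]
  have hrev : p.reverse = C ((-c) ^ m) * (X - C c⁻¹) ^ m * r.reverse := by
    rw [← hdec, reverse_mul_of_domain, hrevpow, hrevX, h1, mul_pow, C_pow]
  have hrev_r : ¬ (r.reverse).IsRoot c⁻¹ := by
    haveI : Invertible c := invertibleOfNonzero hc
    have h : r.reverse.eval c⁻¹ * c ^ r.natDegree = r.eval c := by
      have := eval₂_reverse_mul_pow (RingHom.id K) c r
      rwa [invOf_eq_inv] at this
    intro h0
    rw [IsRoot.def] at h0
    rw [h0, zero_mul] at h
    exact hrc h.symm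
  have hA : C ((-c) ^ m) * (X - C c⁻¹) ^ m ≠ 0 :=
    mul_ne_zero (C_ne_zero.mpr (pow_ne_zero _ (neg_ne_zero.mpr hc))) (pow_ne_zero _ (X_sub_C_ne_zero _))
  have hB : r.reverse ≠ 0 := fun h => hr0 (reverse_eq_zero.mp h)
  rw [hrev, rootMultiplicity_mul (mul_ne_zero hA hB), rootMultiplicity_mul hA, rootMultiplicity_C,
    zero_add, rootMultiplicity_X_sub_C_pow, rootMultiplicity_eq_zero hrev_r, add_zero]

/-! ## §2 Generalized eigenspaces of a scalar multiple of an endomorphism -/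

/-- **`(a • f)_(aμ) = f_(μ)` for `a ≠ 0`**: the generalized eigenspace of `a • f` for `a μ` is the
generalized eigenspace of `f` for `μ` (`(a•f - aμ)ⁿ = aⁿ (f - μ)ⁿ`). Applied to the twisted Frobenius
`χ(F)^r F`: `H^{2r}(X)(r)_1 = H^{2r}(X)_{χ(F)^{-r}}` (for `χ(F) = q⁻¹`, the generalized eigenspace of
`q^r`). [cite: Milne2007TateFiniteFieldsAIM, §1 (the generalized eigenspace H^{2r}(X, ℚ_ℓ(r))_1)] -/
theorem maxGenEigenspace_smul_eq {K : Type*} [Field K] {V : Type*} [AddCommGroup V] [Module K V]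
    (f : Module.End K V) {a : K} (ha : a ≠ 0) (μ : K) :
    Module.End.maxGenEigenspace (a • f) (a * μ) = Module.End.maxGenEigenspace f μ := by
  ext x
  simp only [Module.End.mem_maxGenEigenspace]
  have key : ∀ n : ℕ, ((a • f - (a * μ) • (1 : Module.End K V)) ^ n) x = 0 ↔
      ((f - μ • (1 : Module.End K V)) ^ n) x = 0 := by
    intro n
    have hsub : a • f - (a * μ) • (1 : Module.End K V) = a • (f - μ • 1) := by
      rw [smul_sub, mul_smul]
    rw [hsub, smul_pow, LinearMap.smul_apply, smul_eq_zero]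
    exact ⟨fun h ↦ h.resolve_left (pow_ne_zero n ha), fun h ↦ Or.inr h⟩
  exact exists_congr key

namespace GaloisWeilCohomology

variable {k : Type u} [Field k] [Finite k] {K : Type v} [Field K] [CharZero K]
  {χ : Field.absoluteGaloisGroup k →* Kˣ} (E : GaloisWeilCohomology k K χ)
variable {d : ℕ} {X : SchemeOver k}

/-! ## §3 `dim Hⁱ(X)(j)_1 = mult_{χ(F)^j} P_i(X, t)` and Tate's theorem in Milne's form -/

/-- The twisted Frobenius is the scalar multiple `χ(F)^j • F` of the Frobenius endomorphism
(`j ≥ 0`). [cite: Tate1994, §1] -/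
theorem ρTwist_geomFrob_natCast (X : SchemeOver k) (i j : ℕ) :
    E.ρTwist X i j (geomFrob k) = (((χ (geomFrob k) : Kˣ) : K) ^ j) • E.frobAction X i := by
  ext x
  rw [ρTwist_apply, zpow_natCast, LinearMap.smul_apply, frobAction_def]

/-- **`dim_K Hⁱ(X)(j)_1 = mult_{c^j} P_i(X, t)`**, `c = χ(geomFrob k)`: the dimension of the
generalized eigenspace of `1` of the twisted Frobenius `c^j F` on `Hⁱ(X)` equals the multiplicity of
`c^j` as a root of `P_i(X, t) = det(1 - tF | Hⁱ(X))` (`E.frobCharPoly X i`), i.e. «the multiplicity of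
`c^{-j}` (`= q^j` for the cyclotomic `χ`) as an inverse root of `P_i`».
[cite: Milne1986ValuesZetaFunctionsFiniteFields, §8 p. 345 T(X, r, ℓ)]
[cite: Deligne1974, (1.5.4)] -/
theorem finrank_maxGenEigenspace_ρTwist_eq_rootMultiplicity (hX : IsSmoothProjective d X)
    (i j : ℕ) :
    Module.finrank K (Module.End.maxGenEigenspace (E.ρTwist X i j (geomFrob k)) 1) =
      (E.frobCharPoly X i).rootMultiplicity (((χ (geomFrob k) : Kˣ) : K) ^ j) := by
  haveI := E.finite_obj hX i
  set c : K := ((χ (geomFrob k) : Kˣ) : K) with hc_def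
  have hc : c ≠ 0 := (χ (geomFrob k)).ne_zero
  have hcj : c ^ j ≠ 0 := pow_ne_zero j hc
  rw [E.ρTwist_geomFrob_natCast X i j, ← hc_def]
  have h1 : Module.End.maxGenEigenspace ((c ^ j) • E.frobAction X i) 1 =
      Module.End.maxGenEigenspace (E.frobAction X i) (c ^ j)⁻¹ := by
    rw [← maxGenEigenspace_smul_eq (E.frobAction X i) hcj (c ^ j)⁻¹, mul_inv_cancel₀ hcj]
  rw [h1, LinearMap.finrank_maxGenEigenspace_eq, E.frobCharPoly_of_finite X i,
    ← rootMultiplicity_inv_reverse_aux _ (inv_ne_zero hcj), inv_inv]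

/-- **`dim K·Aʳ(X) ≤ dim Ker(φ_r - 1) ≤ mult_{c^r} P_{2r}(X, t)`**: the number of independent algebraic
classes of codimension `r` is at most the multiplicity of `c^r` (`= q^{-r}`) as a root of
`P_{2r}(X, t) = det(1 - tF | H^{2r}(X))`. [cite: Milne1986ValuesZetaFunctionsFiniteFields, §8 Prop. 8.2 (proof)]
[cite: Tate1994, §2 Th. 2.9] -/
theorem finrank_algebraicClasses_le_rootMultiplicity_frobCharPoly (hX : IsSmoothProjective d X)
    (r : ℕ) :
    Module.finrank K (E.algebraicClasses X r) ≤
      (E.frobCharPoly X (2 * r)).rootMultiplicity (((χ (geomFrob k) : Kˣ) : K) ^ r) := by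
  rw [← E.finrank_maxGenEigenspace_ρTwist_eq_rootMultiplicity hX (2 * r) r]
  exact E.finrank_algebraicClasses_le_finrank_maxGenEigenspace hX r

/-- **Milne 1986 Prop. 8.2 verbatim — `T(X, r) ⟺ (T′(X, r) and SS(X, r))`**: «the dimension of
`B^r_ℓ(X)` is the multiplicity of `q^r` as an inverse root of `P_{2r}(X, t)`» (`dim K·Aʳ(X) =
mult_{c^r} det(1 - tF | H^{2r})`) iff `K·Aʳ(X) = Ker(φ_r - 1)` and `1` is a semisimple eigenvalue of
`φ_r = c^r F`. [cite: Milne1986ValuesZetaFunctionsFiniteFields, §8 Prop. 8.2] [cite: Tate1994, §2 Th. 2.9] -/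
theorem finrank_algebraicClasses_eq_rootMultiplicity_frobCharPoly_iff (hX : IsSmoothProjective d X)
    (r : ℕ) :
    Module.finrank K (E.algebraicClasses X r) =
        (E.frobCharPoly X (2 * r)).rootMultiplicity (((χ (geomFrob k) : Kˣ) : K) ^ r) ↔
      E.algebraicClasses X r = LinearMap.ker (E.ρTwist X (2 * r) r (geomFrob k) - 1) ∧
        LinearMap.ker (E.ρTwist X (2 * r) r (geomFrob k) - 1) ⊓
          LinearMap.range (E.ρTwist X (2 * r) r (geomFrob k) - 1) = ⊥ := by
  rw [← E.finrank_maxGenEigenspace_ρTwist_eq_rootMultiplicity hX (2 * r) r]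
  exact E.finrank_algebraicClasses_eq_iff hX r

/-- **Milne's `T(X, r)` implies the tree's `E.TateConjectureFor X r`** (the `Γ_k`-invariant form)
and `S(r)`. [cite: Milne1986ValuesZetaFunctionsFiniteFields, §8 Prop. 8.2] -/
theorem tateConjectureFor_of_finrank_eq_rootMultiplicity_frobCharPoly (hX : IsSmoothProjective d X)
    (r : ℕ) (hT : Module.finrank K (E.algebraicClasses X r) =
      (E.frobCharPoly X (2 * r)).rootMultiplicity (((χ (geomFrob k) : Kˣ) : K) ^ r)) :
    E.TateConjectureFor X r ∧
      LinearMap.ker (E.ρTwist X (2 * r) r (geomFrob k) - 1) ⊓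
        LinearMap.range (E.ρTwist X (2 * r) r (geomFrob k) - 1) = ⊥ := by
  rw [← E.finrank_maxGenEigenspace_ρTwist_eq_rootMultiplicity hX (2 * r) r] at hT
  exact E.tateConjectureFor_of_finrank_algebraicClasses_eq hX r hT

/-- **`mult_{c^s} P_{2s}(X, t) = mult_{c^r} P_{2r}(X, t)` for `r + s = dim X`** (Poincaré duality:
`q^{d-r}` is an inverse root of `P_{2(d-r)}` with the same multiplicity as `q^r` of `P_{2r}`).
[cite: Tate1994, §2 (proof of Th. 2.9)] [cite: Kahn2020, §6.14 Th. 6.53] -/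
theorem rootMultiplicity_frobCharPoly_eq_of_add_eq (hX : IsSmoothProjective d X) {r s : ℕ}
    (hrs : r + s = d) :
    (E.frobCharPoly X (2 * s)).rootMultiplicity (((χ (geomFrob k) : Kˣ) : K) ^ s) =
      (E.frobCharPoly X (2 * r)).rootMultiplicity (((χ (geomFrob k) : Kˣ) : K) ^ r) := by
  rw [← E.finrank_maxGenEigenspace_ρTwist_eq_rootMultiplicity hX (2 * r) r,
    ← E.finrank_maxGenEigenspace_ρTwist_eq_rootMultiplicity hX (2 * s) s]
  exact E.finrank_maxGenEigenspace_frob_eq hX hrs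

/-- **Milne 1986 Cor. 8.3 verbatim — `(T′(X, r) and T(X, d−r)) ⟹ T(X, r)`**, multiplicities read
on `P_{2r}`, `P_{2(d-r)}`. [cite: Milne1986ValuesZetaFunctionsFiniteFields, §8 Cor. 8.3] -/
theorem finrank_algebraicClasses_eq_rootMultiplicity_frobCharPoly_of_add_eq
    (hX : IsSmoothProjective d X) {r s : ℕ} (hrs : r + s = d)
    (hT' : E.algebraicClasses X r = LinearMap.ker (E.ρTwist X (2 * r) r (geomFrob k) - 1))
    (hT : Module.finrank K (E.algebraicClasses X s) =
      (E.frobCharPoly X (2 * s)).rootMultiplicity (((χ (geomFrob k) : Kˣ) : K) ^ s)) :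
    Module.finrank K (E.algebraicClasses X r) =
      (E.frobCharPoly X (2 * r)).rootMultiplicity (((χ (geomFrob k) : Kˣ) : K) ^ r) := by
  rw [← E.finrank_maxGenEigenspace_ρTwist_eq_rootMultiplicity hX] at hT ⊢
  exact E.finrank_algebraicClasses_eq_of_add_eq hX hrs hT' hT

/-- **Milne 1986 Prop. 8.4 verbatim, second arrow — `T(X, d−r) ⟹ CH^r_hom(X) = CH^r_num(X)`**:
if `dim K·Aˢ(X) = mult_{c^s} P_{2s}` then the Poincaré pairing `Aʳ(X)_ℚ × Aˢ(X)_ℚ → K` has trivial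
left kernel. [cite: Milne1986ValuesZetaFunctionsFiniteFields, §8 Prop. 8.4] -/
theorem homNum_of_finrank_algebraicClasses_eq_rootMultiplicity_frobCharPoly
    (hX : IsSmoothProjective d X) {r s : ℕ} (hrs : r + s = d) (h : 2 * r + 2 * s = 2 * d)
    (hT : Module.finrank K (E.algebraicClasses X s) =
      (E.frobCharPoly X (2 * s)).rootMultiplicity (((χ (geomFrob k) : Kˣ) : K) ^ s)) :
    ∀ x ∈ E.ratAlgebraicClasses X r, (∀ y ∈ E.ratAlgebraicClasses X s,
        E.cupPairing X d (2 * r) (2 * s) h x y = 0) → x = 0 := by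
  rw [← E.finrank_maxGenEigenspace_ρTwist_eq_rootMultiplicity hX] at hT
  exact E.homNum_of_finrank_algebraicClasses_eq hX hrs h hT

/-- **Milne 1986 Prop. 8.4 verbatim, first arrow — `(T′(X, r) and CH^r_hom = CH^r_num) ⟹
T(X, d−r)`**. [cite: Milne1986ValuesZetaFunctionsFiniteFields, §8 Prop. 8.4] -/
theorem finrank_algebraicClasses_eq_rootMultiplicity_frobCharPoly_of_homNum
    (hX : IsSmoothProjective d X) {r s : ℕ} (hrs : r + s = d) (h : 2 * r + 2 * s = 2 * d)
    (hT' : E.algebraicClasses X r = LinearMap.ker (E.ρTwist X (2 * r) r (geomFrob k) - 1))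
    (hE : ∀ x ∈ E.ratAlgebraicClasses X r, (∀ y ∈ E.ratAlgebraicClasses X s,
        E.cupPairing X d (2 * r) (2 * s) h x y = 0) → x = 0) :
    Module.finrank K (E.algebraicClasses X s) =
      (E.frobCharPoly X (2 * s)).rootMultiplicity (((χ (geomFrob k) : Kˣ) : K) ^ s) := by
  rw [← E.finrank_maxGenEigenspace_ρTwist_eq_rootMultiplicity hX]
  exact E.finrank_algebraicClasses_eq_of_homNum hX hrs h hT' hE

/-- **`ρ_r ≤ mult_{c^r} P_{2r}(X, t)`**: the rank of the numerical classes of codimension `r` (the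
rank of the Poincaré pairing on `K·Aʳ(X) × K·Aˢ(X)`) is at most the multiplicity of `c^r` as a root of
`det(1 - tF | H^{2r}(X))` — the inequality «`rg A^r_num(X) ≤` order of the pole» behind Kahn's
Conj. 6.52. [cite: Kahn2020, §6.14 Conj. 6.52 and Th. 6.53] [cite: Tate1994, §2 Th. 2.9] -/
theorem rank_le_rootMultiplicity_frobCharPoly (hX : IsSmoothProjective d X) {r s : ℕ}
    (h : 2 * r + 2 * s = 2 * d) :
    Module.finrank K (LinearMap.range ((E.cupPairing X d (2 * r) (2 * s) h).domRestrict₁₂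
        (E.algebraicClasses X r) (E.algebraicClasses X s))) ≤
      (E.frobCharPoly X (2 * r)).rootMultiplicity (((χ (geomFrob k) : Kˣ) : K) ^ r) := by
  rw [← E.finrank_maxGenEigenspace_ρTwist_eq_rootMultiplicity hX (2 * r) r]
  exact E.rank_le_finrank_maxGenEigenspace hX h

/-- **Tate 1994 Th. 2.9 `(c) ⟺ (a)` with the Frobenius polynomial**: `ρ_r = mult_{c^r} P_{2r}(X, t)`
(«the order of the pole of `Z(X, t)` at `t = q^{-r}` — the multiplicity of the inverse root `q^r` of
`P_{2r}` — equals the rank of the group of numerical equivalence classes of codimension-`r` cycles»)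
iff `K·Aʳ(X) = Ker(φ_r - 1)` and `E(r, s)`. [cite: Tate1994, §2 Th. 2.9]
[cite: Milne2007TateFiniteFieldsAIM, Th. 1.2] [cite: Kahn2020, §6.14 Th. 6.53] -/
theorem rank_eq_rootMultiplicity_frobCharPoly_iff (hX : IsSmoothProjective d X) {r s : ℕ}
    (hrs : r + s = d) (h : 2 * r + 2 * s = 2 * d) :
    Module.finrank K (LinearMap.range ((E.cupPairing X d (2 * r) (2 * s) h).domRestrict₁₂
          (E.algebraicClasses X r) (E.algebraicClasses X s))) =
        (E.frobCharPoly X (2 * r)).rootMultiplicity (((χ (geomFrob k) : Kˣ) : K) ^ r) ↔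
      (E.algebraicClasses X r = LinearMap.ker (E.ρTwist X (2 * r) r (geomFrob k) - 1) ∧
        ∀ x ∈ E.ratAlgebraicClasses X r, (∀ y ∈ E.ratAlgebraicClasses X s,
          E.cupPairing X d (2 * r) (2 * s) h x y = 0) → x = 0) := by
  rw [← E.finrank_maxGenEigenspace_ρTwist_eq_rootMultiplicity hX (2 * r) r]
  exact E.rank_eq_finrank_maxGenEigenspace_iff hX hrs h

/-- **Tate 1994 Th. 2.9 `(c) ⟺ (b)` = Kahn 2020 Th. 6.53 with the Frobenius polynomial**:
`ρ_r = mult_{c^r} P_{2r}(X, t)` iff `T_F(r) ∧ T_F(s) ∧ S(r)`. [cite: Kahn2020, §6.14 Th. 6.53]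
[cite: Tate1994, §2 Th. 2.9] [cite: Milne2012AddendumZetaValues, §0.4] -/
theorem rank_eq_rootMultiplicity_frobCharPoly_iff' (hX : IsSmoothProjective d X) {r s : ℕ}
    (hrs : r + s = d) (h : 2 * r + 2 * s = 2 * d) :
    Module.finrank K (LinearMap.range ((E.cupPairing X d (2 * r) (2 * s) h).domRestrict₁₂
          (E.algebraicClasses X r) (E.algebraicClasses X s))) =
        (E.frobCharPoly X (2 * r)).rootMultiplicity (((χ (geomFrob k) : Kˣ) : K) ^ r) ↔
      (E.algebraicClasses X r = LinearMap.ker (E.ρTwist X (2 * r) r (geomFrob k) - 1) ∧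
        E.algebraicClasses X s = LinearMap.ker (E.ρTwist X (2 * s) s (geomFrob k) - 1) ∧
        LinearMap.ker (E.ρTwist X (2 * r) r (geomFrob k) - 1) ⊓
          LinearMap.range (E.ρTwist X (2 * r) r (geomFrob k) - 1) = ⊥) := by
  rw [← E.finrank_maxGenEigenspace_ρTwist_eq_rootMultiplicity hX (2 * r) r]
  exact E.rank_eq_finrank_maxGenEigenspace_iff' hX hrs h

/-- **Under `(c)` (Frobenius-polynomial form) all the ranks agree**:
`ρ_r = dim K·Aʳ(X) = mult_{c^r} P_{2r} = mult_{c^s} P_{2s} = dim K·Aˢ(X)`, `r + s = dim X`.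
[cite: Tate1994, §2 Th. 2.9] [cite: Milne2007TateFiniteFieldsAIM, Th. 1.2] -/
theorem finrank_algebraicClasses_eq_of_rank_eq_rootMultiplicity (hX : IsSmoothProjective d X)
    {r s : ℕ} (hrs : r + s = d) (h : 2 * r + 2 * s = 2 * d)
    (hc : Module.finrank K (LinearMap.range ((E.cupPairing X d (2 * r) (2 * s) h).domRestrict₁₂
          (E.algebraicClasses X r) (E.algebraicClasses X s))) =
        (E.frobCharPoly X (2 * r)).rootMultiplicity (((χ (geomFrob k) : Kˣ) : K) ^ r)) :
    Module.finrank K (E.algebraicClasses X r) =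
        (E.frobCharPoly X (2 * r)).rootMultiplicity (((χ (geomFrob k) : Kˣ) : K) ^ r) ∧
      Module.finrank K (E.algebraicClasses X s) =
        (E.frobCharPoly X (2 * s)).rootMultiplicity (((χ (geomFrob k) : Kˣ) : K) ^ s) ∧
      (E.frobCharPoly X (2 * s)).rootMultiplicity (((χ (geomFrob k) : Kˣ) : K) ^ s) =
        (E.frobCharPoly X (2 * r)).rootMultiplicity (((χ (geomFrob k) : Kˣ) : K) ^ r) := by
  rw [← E.finrank_maxGenEigenspace_ρTwist_eq_rootMultiplicity hX (2 * r) r] at hc ⊢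
  rw [← E.finrank_maxGenEigenspace_ρTwist_eq_rootMultiplicity hX (2 * s) s]
  obtain ⟨h1, -, h3, h4⟩ := E.finrank_eq_of_rank_eq hX hrs h hc
  exact ⟨h1, h3, h4⟩

end GaloisWeilCohomology

end Literature.AlgebraicGeometry.Motives

end
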